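/-
Copyright: the b2b-balaban T⁴-continuum CRUX team, row NE7b OWNER lineage `t4-ne7b-p1` (gen 128). Project licence.
-/
import Summits.QuantumFields.BalabanUV.T4Continuum.Spine.NE7b.SupRoadFactorRegulated
import Summits.QuantumFields.BalabanUV.T4Continuum.Spine.NE7b.LocalNemytskiiSup

/-!
# THE ROAD'S POTENTIAL CLASS SUPPLIES (290)'s INPUTS: for a `C²` single-site potential `u` with `u″ ≥ −λ` everywhere and `u″`
# `L`-Lipschitz, the third-order Taylor remainder `w_a(t) = u(a+t) − u(a) − u′(a)t − ½u″(a)t²` at any background value `a` is CUBICALLY SMALL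
# (`|w_a(t)| ≤ L|t|³`) and STABLE (`w_a(t) ≥ −½(λ + u″(a))t²`), so on a background with `u″(φ_x) ≤ Λ` the road's fluctuation factors
# `e^{−Σ_{x∈p}w_{φ_x}(ζ_x)} − 1` satisfy (290) with `κ₀ = ½(λ+Λ)`, `c₃ = L` and EVERY `h ≥ 0`: over a finite-range Gaussian scale with
# `Γ ⪯ γ_op·1`, `(λ+Λ) ≤ κ`, `κγ_op ≤ θ < 1`, the perturbation is a zero-free polymer gas with
# `‖log Z(C)‖ ≤ #C(Δ+1)2e·max(e^{Lvh³}−1, 2e^{−(κ∕2−(λ+Λ)∕2)h²})·A^v` (row NE7b, node U5c; (290) BY NAME + one-variable calculus; [folklore])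

Cell `pub-balaban`, sub-cell `t4`, spine estimate NE7b (`T4WeightBudget.RelWeightBound`; the cell's OWN estimate — NOT PRINTED in
[Bałaban 1983–89], NOT PROVED).  Crux-route work under `Spine/NE7b/` by the row OWNER (`t4-ne7b-p1` gen 128, file (293)) under FREEZE
(0)'s crux-prover clause, on § [NE7bP1-G127-HANDOFF] NEXT (3)(b); NOTHING of Bałaban's is named as a Lean object, valued or asserted; no
`T4Continuum/Support` leaf typed; no `def`, no notation; zero `sorry`.  Imports (BY NAME): the OWNER's (290) `…SupRoadFactorRegulated`
(`road_pertZ_ne_zero`, `road_norm_pertLogZ_le`), (58) `…LocalNemytskiiSup` (`abs_taylor_two`: second-order Taylor with a Lipschitz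
derivative, by the mean-value inequality); Mathlib's `Convex.norm_image_sub_le_of_norm_hasDerivWithin_le`, `monotone_of_deriv_nonneg`,
`monotoneOn_of_deriv_nonneg`, `antitoneOn_of_deriv_nonpos`.

WHY (located).  (290) took the per-site remainders' STABILITY and CUBIC SMALLNESS as inputs.  For the road they are one-variable calculus
on the single-site potential of the class (`u″ ≥ −λ`, `u″(φ_x) ≤ Λ` on the background, `u″` Lipschitz): this file proves them and closes
the chain «potential class ⟹ regulated factors ⟹ activity bound ⟹ convergent polymer gas, uniformly in the volume» of gen 128 with
no analytic input left open at this (one-scale, scalar) level.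

WHAT IS PROVED ([folklore]; `u, u′, u″ : ℝ → ℝ` with `HasDerivAt u (u′ t) t`, `HasDerivAt u′ (u″ t) t` for all `t`):
* §1 **`abs_taylor_three`** (`u″` `L`-Lipschitz ⟹ `|u(a+b) − u(a) − u′(a)b − ½u″(a)b²| ≤ L|b|³`: (58)'s `abs_taylor_two` for `u′` bounds the
  remainder's derivative by `Lb²` on the segment, then the mean-value inequality);
* §2 **`taylor_three_stable`** (`u″ ≥ −λ` everywhere ⟹ `−½(λ+u″(a))b² ≤ u(a+b) − u(a) − u′(a)b − ½u″(a)b²`: `v(t) = remainder + ½(λ+u″(a))t²`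
  has `v″ = u″(a+·) + λ ≥ 0`, `v(0) = v′(0) = 0`, so `v′` is monotone and `v ≥ 0` on both half-lines);
* §3 the road's remainders `w_x(t) = u(φ_x+t) − u(φ_x) − u′(φ_x)t − ½u″(φ_x)t²`: `road_remainder_stable` (`u″(φ_x) ≤ Λ` ⟹
  `w_x(t) ≥ −((λ+Λ)∕2)t²`), `road_remainder_cubic` (`|w_x(t)| ≤ L|t|³`), `road_remainder_measurable` (the remainders are continuous);
  `0 ≤ λ + Λ` is ASSUMED in §4 (it follows from `−λ ≤ u″(φ_x) ≤ Λ` at any one site);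
* §4 THE END for the road's potential class over a finite-range Gaussian reference: **`potential_pertZ_ne_zero`** and
  **`potential_norm_pertLogZ_le`** ((290) with `κ₀ = (λ+Λ)∕2`, `c₃ = L`, any `h ≥ 0`, any `κ ≥ λ+Λ` with `κγ_op ≤ θ < 1`); §5 toy.

HONEST (what this is NOT).  One-variable calculus; the class constants `λ, Λ, L` are the road's (near-convex single-site potential with
Lipschitz second derivative — for `φ⁴` at weak coupling `u″ = 12gφ²` is Lipschitz only on bounded backgrounds ∕ fields, so `L` is a
window constant and the unbounded-field tail belongs to the large-field bookkeeping, not typed); one scale; scalar skeleton ((A3),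
NC-NE7b-α UNRULED); nothing of Bałaban's asserted.  BY-NAME EFFECT ON THE WALL: NONE.  NE7b NOT PRINTED ∕ NOT PROVED; spine PROVED 0∕9; rung
(B)+1 — the programme's measures remain FINITE-torus statements; NOT the mass gap, NOT Clay.  HONEST DEPENDENCY: continuum YM on T⁴ ⇐
BetaPertH ∧ nine spine estimates (0∕9 proved); BetaPertH ⇐ (D1) ∧ (D4) ∧ CAP+tail; G-an2-4 gates asym, D1 and NE2∕3∕4.
-/

set_option autoImplicit false

noncomputable section

namespace Summit.QuantumFields.BalabanUV.T4Continuum.NE7b.SupRoadTaylorRemainder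

open MeasureTheory ProbabilityTheory Finset Real Set
open scoped BigOperators
open Literature.Probability.LatticeModels (pertZ pertLogZ)
open Literature.Analysis.Matrix (HasFiniteRange)
open SupRoadFactorRegulated (road_pertZ_ne_zero road_norm_pertLogZ_le)
open LocalNemytskiiSup (abs_taylor_two)

variable {ι : Type} [Fintype ι] [DecidableEq ι] {V : Type*}

/-! ## §1. Third-order Taylor with a Lipschitz second derivative -/

/-- **THIRD-ORDER TAYLOR, CUBIC SIZE**: `u ∈ C²` with `u″` `L`-Lipschitz ⟹ `|u(a+b) − u(a) − u′(a)b − ½u″(a)b²| ≤ L|b|³`. [folklore] -/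
theorem abs_taylor_three {u u' u'' : ℝ → ℝ} (hu : ∀ t, HasDerivAt u (u' t) t) (hu' : ∀ t, HasDerivAt u' (u'' t) t) {L : ℝ}
    (hL : ∀ s t, |u'' s - u'' t| ≤ L * |s - t|) (a b : ℝ) :
    |u (a + b) - u a - u' a * b - u'' a / 2 * b ^ 2| ≤ L * |b| ^ 3 := by
  -- the remainder `w(t) = u(a+t) − u′(a)t − ½u″(a)t²` and its derivative on the segment `uIcc 0 b`
  have hderiv : ∀ t ∈ uIcc (0 : ℝ) b, HasDerivWithinAt (fun t => u (a + t) - u' a * t - u'' a / 2 * t ^ 2)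
      (u' (a + t) - u' a - u'' a * t) (uIcc (0 : ℝ) b) t := by
    intro t _
    have h1 : HasDerivAt (fun t => u (a + t)) (u' (a + t)) t := HasDerivAt.comp_const_add a t (hu (a + t))
    have h2 : HasDerivAt (fun t => u' a * t) (u' a) t := by simpa using (hasDerivAt_id t).const_mul (u' a)
    have hp : HasDerivAt (fun t : ℝ => t ^ 2) (2 * t) t := by simpa using hasDerivAt_pow 2 t
    have h3 : HasDerivAt (fun t => u'' a / 2 * t ^ 2) (u'' a * t) t := (hp.const_mul (u'' a / 2)).congr_deriv (by ring)
    exact ((h1.sub h2).sub h3).hasDerivWithinAt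
  have hL0 : 0 ≤ L := by
    have h2 : (0 : ℝ) ≤ L * |(1 : ℝ) - 0| := (abs_nonneg _).trans (hL 1 0)
    simpa using h2
  have hbound : ∀ t ∈ uIcc (0 : ℝ) b, ‖u' (a + t) - u' a - u'' a * t‖ ≤ L * b ^ 2 := by
    intro t ht
    rw [Real.norm_eq_abs]
    have ht' : |t| ≤ |b| := by
      rcases le_total 0 b with hb | hb
      · rw [uIcc_of_le hb] at ht
        rw [abs_of_nonneg ht.1, abs_of_nonneg hb]; exact ht.2
      · rw [uIcc_of_ge hb] at ht
        rw [abs_of_nonpos ht.2, abs_of_nonpos hb]; linarith [ht.1]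
    calc |u' (a + t) - u' a - u'' a * t| ≤ L * t ^ 2 := abs_taylor_two hu' hL a t
      _ ≤ L * b ^ 2 := by
          refine mul_le_mul_of_nonneg_left ?_ hL0
          rw [← sq_abs t, ← sq_abs b]
          exact pow_le_pow_left₀ (abs_nonneg t) ht' 2
  have h := Convex.norm_image_sub_le_of_norm_hasDerivWithin_le hderiv hbound (convex_uIcc 0 b) left_mem_uIcc right_mem_uIcc
  simp only [add_zero, mul_zero, sub_zero, Real.norm_eq_abs, ne_eq, OfNat.ofNat_ne_zero, not_false_eq_true, zero_pow] at h
  calc |u (a + b) - u a - u' a * b - u'' a / 2 * b ^ 2| = |u (a + b) - u' a * b - u'' a / 2 * b ^ 2 - u a| := by ring_nf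
    _ ≤ L * b ^ 2 * |b| := h
    _ = L * |b| ^ 3 := by rw [← sq_abs b]; ring

/-! ## §2. Stability of the third-order remainder from a lower bound on `u″` -/

/-- **THIRD-ORDER TAYLOR, STABILITY**: `u ∈ C²` with `u″ ≥ −λ` everywhere ⟹ for all `a, b`:
`−½(λ + u″(a))·b² ≤ u(a+b) − u(a) − u′(a)b − ½u″(a)b²` (the function `t ↦ u(a+t) − u(a) − u′(a)t + ½λt²` is convex with value and slope
`0` at `t = 0`). [folklore] -/
theorem taylor_three_stable {u u' u'' : ℝ → ℝ} (hu : ∀ t, HasDerivAt u (u' t) t) (hu' : ∀ t, HasDerivAt u' (u'' t) t) {lam : ℝ}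
    (hlam : ∀ t, -lam ≤ u'' t) (a b : ℝ) :
    -((lam + u'' a) / 2 * b ^ 2) ≤ u (a + b) - u a - u' a * b - u'' a / 2 * b ^ 2 := by
  -- `v(t) = u(a+t) − u(a) − u′(a)t + ½λt²`, `v′(t) = u′(a+t) − u′(a) + λt`, `v″ = u″(a+t) + λ ≥ 0`
  have hvd : ∀ t, HasDerivAt (fun t => u (a + t) - u a - u' a * t + lam / 2 * t ^ 2) (u' (a + t) - u' a + lam * t) t := by
    intro t
    have h1 : HasDerivAt (fun t => u (a + t)) (u' (a + t)) t := HasDerivAt.comp_const_add a t (hu (a + t))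
    have h2 : HasDerivAt (fun t => u' a * t) (u' a) t := by simpa using (hasDerivAt_id t).const_mul (u' a)
    have hp : HasDerivAt (fun t : ℝ => t ^ 2) (2 * t) t := by simpa using hasDerivAt_pow 2 t
    have h3 : HasDerivAt (fun t => lam / 2 * t ^ 2) (lam * t) t := (hp.const_mul (lam / 2)).congr_deriv (by ring)
    exact ((h1.sub_const (u a)).sub h2).add h3
  have hv'd : ∀ t, HasDerivAt (fun t => u' (a + t) - u' a + lam * t) (u'' (a + t) + lam) t := by
    intro t
    have h1 : HasDerivAt (fun t => u' (a + t)) (u'' (a + t)) t := HasDerivAt.comp_const_add a t (hu' (a + t))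
    have h2 : HasDerivAt (fun t => lam * t) lam t := by simpa using (hasDerivAt_id t).const_mul lam
    exact (h1.sub_const (u' a)).add h2
  -- `v′` is monotone with `v′(0) = 0`
  have hmono : Monotone (fun t => u' (a + t) - u' a + lam * t) :=
    monotone_of_deriv_nonneg (fun t => (hv'd t).differentiableAt) fun t => by
      rw [(hv'd t).deriv]; linarith [hlam (a + t)]
  have hv'0 : (fun t => u' (a + t) - u' a + lam * t) 0 = 0 := by simp
  have hvdiff : Differentiable ℝ (fun t => u (a + t) - u a - u' a * t + lam / 2 * t ^ 2) := fun t => (hvd t).differentiableAt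
  -- `v ≥ v(0) = 0` on both half-lines
  have hvb : (fun t => u (a + t) - u a - u' a * t + lam / 2 * t ^ 2) 0 ≤
      (fun t => u (a + t) - u a - u' a * t + lam / 2 * t ^ 2) b := by
    rcases le_total 0 b with hb | hb
    · have hm : MonotoneOn (fun t => u (a + t) - u a - u' a * t + lam / 2 * t ^ 2) (Ici 0) :=
        monotoneOn_of_deriv_nonneg (convex_Ici 0) hvdiff.continuous.continuousOn hvdiff.differentiableOn fun x hx => by
          rw [interior_Ici] at hx
          rw [(hvd x).deriv]
          have := hmono hx.le
          simp only [add_zero, sub_self, mul_zero] at this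
          exact this
      exact hm (self_mem_Ici (a := (0 : ℝ))) (mem_Ici.2 hb) hb
    · have hm : AntitoneOn (fun t => u (a + t) - u a - u' a * t + lam / 2 * t ^ 2) (Iic 0) :=
        antitoneOn_of_deriv_nonpos (convex_Iic 0) hvdiff.continuous.continuousOn hvdiff.differentiableOn fun x hx => by
          rw [interior_Iic] at hx
          rw [(hvd x).deriv]
          have := hmono hx.le
          simp only [add_zero, sub_self, mul_zero] at this
          exact this
      exact hm (mem_Iic.2 hb) (self_mem_Iic (a := (0 : ℝ))) hb
  simp only [add_zero, sub_self, mul_zero, ne_eq, OfNat.ofNat_ne_zero, not_false_eq_true, zero_pow] at hvb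
  linarith

/-! ## §3. The road's remainders at a background -/

omit [Fintype ι] [DecidableEq ι] in
/-- **STABILITY of the road's remainders**: `u″ ≥ −λ` everywhere and `u″(φ_x) ≤ Λ` at every site ⟹
`w_x(t) = u(φ_x+t) − u(φ_x) − u′(φ_x)t − ½u″(φ_x)t² ≥ −((λ+Λ)∕2)·t²`. [folklore] -/
theorem road_remainder_stable {u u' u'' : ℝ → ℝ} (hu : ∀ t, HasDerivAt u (u' t) t) (hu' : ∀ t, HasDerivAt u' (u'' t) t)
    {lam Lam : ℝ} (hlam : ∀ t, -lam ≤ u'' t) (φ : ι → ℝ) (hLam : ∀ x, u'' (φ x) ≤ Lam) (x : ι) (t : ℝ) :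
    -((lam + Lam) / 2 * t ^ 2) ≤ u (φ x + t) - u (φ x) - u' (φ x) * t - u'' (φ x) / 2 * t ^ 2 := by
  have h := taylor_three_stable hu hu' hlam (φ x) t
  have h2 : (lam + u'' (φ x)) / 2 * t ^ 2 ≤ (lam + Lam) / 2 * t ^ 2 :=
    mul_le_mul_of_nonneg_right (by linarith [hLam x]) (sq_nonneg t)
  linarith

omit [Fintype ι] [DecidableEq ι] in
/-- **CUBIC SMALLNESS of the road's remainders**: `u″` `L`-Lipschitz ⟹ `|w_x(t)| ≤ L|t|³` (for all `t`, in particular for `|t| ≤ h`).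
[folklore] -/
theorem road_remainder_cubic {u u' u'' : ℝ → ℝ} (hu : ∀ t, HasDerivAt u (u' t) t) (hu' : ∀ t, HasDerivAt u' (u'' t) t)
    {L : ℝ} (hL : ∀ s t, |u'' s - u'' t| ≤ L * |s - t|) (φ : ι → ℝ) (x : ι) (t : ℝ) :
    |u (φ x + t) - u (φ x) - u' (φ x) * t - u'' (φ x) / 2 * t ^ 2| ≤ L * |t| ^ 3 :=
  abs_taylor_three hu hu' hL (φ x) t

omit [Fintype ι] [DecidableEq ι] in
/-- The road's remainders are measurable in `t` (indeed continuous). [folklore] -/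
theorem road_remainder_measurable {u u' : ℝ → ℝ} (hu : ∀ t, HasDerivAt u (u' t) t) (u'' : ℝ → ℝ) (φ : ι → ℝ) (x : ι) :
    Measurable fun t : ℝ => u (φ x + t) - u (φ x) - u' (φ x) * t - u'' (φ x) / 2 * t ^ 2 := by
  have hc : Continuous u := continuous_iff_continuousAt.2 fun t => (hu t).continuousAt
  fun_prop

/-! ## §4. THE END: the road's potential class over a finite-range Gaussian reference -/

/-- **ZERO-FREENESS for the road's potential class.**  `u ∈ C²` with `u″ ≥ −λ` everywhere, `u″` `L`-Lipschitz, a background `φ` with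
`u″(φ_x) ≤ Λ` and `0 ≤ λ + Λ`; `Γ ⪰ 0` of range `ρ`, `Γ ⪯ γ_op·1`, diagonal `≤ γ` (`γ ≥ 0`); disjoint cells of `≤ v` sites, an adjacency
covering `ρ`-closeness with `≤ Δ` neighbours; `h ≥ 0`, `λ + Λ ≤ κ`, `0 < θ < 1`, `κγ_op ≤ θ`, `e·ε(h)A^v·(Δ+1)² ≤ 1∕2` ⟹ `Z(C) ≠ 0` for the
factors `e^{−Σ_{x∈cell p} w_x(ω_x)} − 1`. [folklore] -/
theorem potential_pertZ_ne_zero [DecidableEq V] {u u' u'' : ℝ → ℝ} (hu : ∀ t, HasDerivAt u (u' t) t)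
    (hu' : ∀ t, HasDerivAt u' (u'' t) t) {lam Lam L : ℝ} (hlam : ∀ t, -lam ≤ u'' t) (hL : ∀ s t, |u'' s - u'' t| ≤ L * |s - t|)
    (φ : ι → ℝ) (hLam : ∀ x, u'' (φ x) ≤ Lam) (hll : 0 ≤ lam + Lam) {Γ : Matrix ι ι ℝ} {γop γ : ℝ} (hΓ : Γ.PosSemidef)
    (hΓop : (γop • (1 : Matrix ι ι ℝ) - Γ).PosSemidef) (hdiag : ∀ i, Γ i i ≤ γ) (hγ : 0 ≤ γ) {dι : ι → ι → ℕ} {ρ : ℕ}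
    (hfr : HasFiniteRange dι ρ Γ) (cell : V → Finset ι) (hdisj : ∀ p q, p ≠ q → Disjoint (cell p) (cell q)) {v : ℕ}
    (hv : ∀ p, (cell p).card ≤ v) {R : V → V → Prop} [DecidableRel R] (hRsymm : ∀ x y, R x y → R y x)
    (hR : ∀ (p p' : V) (x y : ι), x ∈ cell p → y ∈ cell p' → dι x y ≤ ρ → p = p' ∨ R p p') {nbr : V → Finset V} {Δ : ℕ}
    (hΔ : ∀ x, (nbr x).card ≤ Δ) (hnbr : ∀ x y, R x y → y ∈ nbr x) {h κ θ : ℝ} (hh : 0 ≤ h) (hκ : lam + Lam ≤ κ) (hθ0 : 0 < θ)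
    (hθ1 : θ < 1) (hκθ : κ * γop ≤ θ)
    (hsmall : Real.exp 1 * (max (exp (L * v * h ^ 3) - 1) (2 * exp (-((κ / 2 - (lam + Lam) / 2) * h ^ 2))) *
      ((1 - θ) ^ (-(κ * γ / (2 * θ)))) ^ v) * ((Δ : ℝ) + 1) ^ 2 ≤ 1 / 2) (C : Finset V) :
    pertZ (multivariateGaussian 0 Γ)
      (fun p ω => (((exp (-(∑ x ∈ cell p, (u (φ x + ω x) - u (φ x) - u' (φ x) * ω x - u'' (φ x) / 2 * ω x ^ 2))) - 1 : ℝ)) : ℂ))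
      C ≠ 0 := by
  have hL0 : 0 ≤ L := by
    have h2 : (0 : ℝ) ≤ L * |(1 : ℝ) - 0| := (abs_nonneg _).trans (hL 1 0)
    simpa using h2
  exact road_pertZ_ne_zero hΓ hΓop hdiag hγ hfr cell hdisj hv hRsymm hR hΔ hnbr
    (fun x t => u (φ x + t) - u (φ x) - u' (φ x) * t - u'' (φ x) / 2 * t ^ 2) (fun x => road_remainder_measurable hu u'' φ x)
    (κ₀ := (lam + Lam) / 2) (by linarith) hL0 hh (fun x t => road_remainder_stable hu hu' hlam φ hLam x t)
    (fun x t _ => road_remainder_cubic hu hu' hL φ x t) (by linarith) hθ0 hθ1 hκθ hsmall C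

/-- **THE END — FOR THE ROAD'S POTENTIAL CLASS, `log Z` OF THE FLUCTUATION STEP OVER A FINITE-RANGE GAUSSIAN SCALE IS EXTENSIVE,
UNIFORMLY IN THE VOLUME.**  `u ∈ C²` with `u″ ≥ −λ` everywhere and `u″` `L`-Lipschitz; a background with `u″(φ_x) ≤ Λ`, `0 ≤ λ+Λ`; `Γ ⪰ 0`,
`Γ ⪯ γ_op·1`, diagonal `≤ γ` (`γ ≥ 0`); disjoint cells of `≤ v` sites; a symmetric adjacency with `≤ Δ` neighbours; `h ≥ 0`, `λ+Λ ≤ κ`,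
`0 < θ < 1`, `κγ_op ≤ θ`; `e·ε(h)A^v·(Δ+1)² ≤ 1∕2` with `ε(h) = max(e^{Lvh³} − 1, 2e^{−(κ∕2−(λ+Λ)∕2)h²})`, `A = (1−θ)^{−κγ∕(2θ)}` ⟹
`‖log Z(C)‖ ≤ #C·(Δ+1)·2e·ε(h)A^v`. [folklore] -/
theorem potential_norm_pertLogZ_le [DecidableEq V] {u u' u'' : ℝ → ℝ} (hu : ∀ t, HasDerivAt u (u' t) t)
    (hu' : ∀ t, HasDerivAt u' (u'' t) t) {lam Lam L : ℝ} (hlam : ∀ t, -lam ≤ u'' t) (hL : ∀ s t, |u'' s - u'' t| ≤ L * |s - t|)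
    (φ : ι → ℝ) (hLam : ∀ x, u'' (φ x) ≤ Lam) (hll : 0 ≤ lam + Lam) {Γ : Matrix ι ι ℝ} {γop γ : ℝ} (hΓ : Γ.PosSemidef)
    (hΓop : (γop • (1 : Matrix ι ι ℝ) - Γ).PosSemidef) (hdiag : ∀ i, Γ i i ≤ γ) (hγ : 0 ≤ γ) (cell : V → Finset ι)
    (hdisj : ∀ p q, p ≠ q → Disjoint (cell p) (cell q)) {v : ℕ} (hv : ∀ p, (cell p).card ≤ v) {R : V → V → Prop} [DecidableRel R]
    (hRsymm : ∀ x y, R x y → R y x) {nbr : V → Finset V} {Δ : ℕ} (hΔ : ∀ x, (nbr x).card ≤ Δ) (hnbr : ∀ x y, R x y → y ∈ nbr x)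
    {h κ θ : ℝ} (hh : 0 ≤ h) (hκ : lam + Lam ≤ κ) (hθ0 : 0 < θ) (hθ1 : θ < 1) (hκθ : κ * γop ≤ θ)
    (hsmall : Real.exp 1 * (max (exp (L * v * h ^ 3) - 1) (2 * exp (-((κ / 2 - (lam + Lam) / 2) * h ^ 2))) *
      ((1 - θ) ^ (-(κ * γ / (2 * θ)))) ^ v) * ((Δ : ℝ) + 1) ^ 2 ≤ 1 / 2) (C : Finset V) :
    ‖pertLogZ (multivariateGaussian 0 Γ)
      (fun p ω => (((exp (-(∑ x ∈ cell p, (u (φ x + ω x) - u (φ x) - u' (φ x) * ω x - u'' (φ x) / 2 * ω x ^ 2))) - 1 : ℝ)) : ℂ))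
      R C‖ ≤
      C.card * ((Δ : ℝ) + 1) * (2 * (Real.exp 1 * (max (exp (L * v * h ^ 3) - 1) (2 * exp (-((κ / 2 - (lam + Lam) / 2) * h ^ 2))) *
        ((1 - θ) ^ (-(κ * γ / (2 * θ)))) ^ v))) := by
  have hL0 : 0 ≤ L := by
    have h2 : (0 : ℝ) ≤ L * |(1 : ℝ) - 0| := (abs_nonneg _).trans (hL 1 0)
    simpa using h2
  exact road_norm_pertLogZ_le hΓ hΓop hdiag hγ cell hdisj hv hRsymm hΔ hnbr
    (fun x t => u (φ x + t) - u (φ x) - u' (φ x) * t - u'' (φ x) / 2 * t ^ 2) (κ₀ := (lam + Lam) / 2) (by linarith) hL0 hh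
    (fun x t => road_remainder_stable hu hu' hlam φ hLam x t) (fun x t _ => road_remainder_cubic hu hu' hL φ x t) (by linarith)
    hθ0 hθ1 hκθ hsmall C

/-! ## §5. Toy -/

/-- Toy (§2 for the quadratic potential `u(t) = t²`, `u′ = 2t`, `u″ = 2 ≥ −0`): the third-order remainder at `a` is `0 ≥ −½(0+2)b²`. -/
example (a b : ℝ) : -((0 + 2) / 2 * b ^ 2) ≤ (a + b) ^ 2 - a ^ 2 - 2 * a * b - 2 / 2 * b ^ 2 :=
  taylor_three_stable (u := fun t => t ^ 2) (u' := fun t => 2 * t) (u'' := fun _ => 2)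
    (fun t => by simpa using hasDerivAt_pow 2 t) (fun t => by simpa using (hasDerivAt_id t).const_mul (2 : ℝ))
    (fun _ => by norm_num) a b

end Summit.QuantumFields.BalabanUV.T4Continuum.NE7b.SupRoadTaylorRemainder
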